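import Mathlib.Combinatorics.SimpleGraph.Metric
import Mathlib.Data.Fintype.Card
import Mathlib.Data.Fin.SuccPred
import Mathlib.Tactic.FinCases
import Mathlib.Tactic.NormNum
import Literature.InformationTheory.NetworkCoding.OneShot

/-!
# `CodingVolume` (crux stmt-PneNP-19454, route `CodingVolumeShifts`): load-bearing hypotheses,
# quantifier order and the ceiling `C ≤ L` — negative-side support (refuter crux-attack seat)

`CodingVolume` claims
`∀ Δ C : ℕ, ∃ L : ℕ, ∀ ι [Fintype ι] (N : KPairsNet ι), N.DegLE Δ → N.Far L → Nonempty N.Code →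
C * card ι ≤ N.arcCount`.

Sorry-free facts recorded here (all witnessed by ROUTING on a single commodity — the directed
path `pathNet n` of length `n + 1` with the forwarding code, the one-arc network, and the arcless
network), none of which refutes the crux:

* `pathNet_far`, `pathNet_degLE`, `pathCode`, `pathNet_arcCount` — the hypotheses of the crux are
  JOINTLY SATISFIABLE at every distance scale: `pathNet n` has degrees `≤ 1`, its pair is
  `(n+1)`-far, it carries a code, and it has exactly `n + 1` arcs (non-vacuity, A3).
* `codingVolume_ceiling` — TIGHTNESS: whatever `L` a proof produces for `(Δ, C)` with `Δ ≥ 1`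
  and `L ≥ 1` must satisfy `C ≤ L` (so the value `L = C` predicted by the undirected
  multiple-unicast conjecture is optimal); equivalently the volume bound can never beat routing.
* `codingVolume_false_swapped` — QUANTIFIER ORDER is load-bearing: `∀ Δ ∃ L ∀ C …` is false.
  (All mutated statements are stated inline; no proposition is defined under `Summits/`.)
* `codingVolume_false_without_Far` — dropping `Far` makes the statement false (`C = 2`, one arc).
* `codingVolume_false_without_Code` — dropping `Nonempty N.Code` makes it false: with no arcs the
  pair is undirected-unreachable, hence `Far L` for EVERY `L` (`edist = ⊤`), while `m = 0`.
* `noArc_isEmpty_code` — sanity: the `Code` interface has no junk inhabitant on a sink without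
  in-arcs (decodability fails), so "far by unreachability" never meets a code.

Moral for provers: any proof must use `Far` and the code, must let `L` grow at least linearly
with `C`, and cannot hope for `L < C`. (`DegLE` is not shown load-bearing here: the statement
without it is still implied by the multiple-unicast conjecture.) [folklore]
-/

set_option linter.dupNamespace false

namespace Summit.PneNP.PneNP.Theorems.CodingVolume.Negative

open Literature.InformationTheory.NetworkCoding

/-! ## The routing path of length `n + 1` -/

/-- The directed path `0 → 1 → ⋯ → n+1` on `Fin (n+2)` with arcs `Fin (n+1)` (`a ↦ (a, a+1)`),
one commodity (`Unit`) from `0` to `Fin.last (n+1)`. [folklore] -/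
def pathNet (n : ℕ) : KPairsNet Unit where
  V := Fin (n + 2)
  A := Fin (n + 1)
  src := Fin.castSucc
  tgt := Fin.succ
  rank := Fin.val
  rank_lt := fun a => by simp [Fin.castSucc]
  source := ⟨fun _ => 0, fun _ _ _ => rfl⟩
  sink := ⟨fun _ => Fin.last (n + 1), fun _ _ _ => rfl⟩
  source_in := fun a _ => Fin.succ_ne_zero a
  sink_out := fun a _ => ne_of_lt (Fin.castSucc_lt_last a)

/-- The forwarding (routing) code on the path: every arc carries the source bit. [folklore] -/
def pathCode (n : ℕ) : (pathNet n).Code where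
  val := fun _ x => x ()
  local_ := by
    intro a x x' hb hs
    rcases Fin.eq_zero_or_eq_succ a with h | ⟨b, rfl⟩
    · subst h
      exact hs () rfl
    · exact hb (Fin.castSucc b) (Fin.succ_castSucc b).symm
  decode := by
    intro i x x' hb
    exact hb (Fin.last n) rfl

/-- The path has exactly `n + 1` arcs. [folklore] -/
theorem pathNet_arcCount (n : ℕ) : (pathNet n).arcCount = n + 1 := by
  show Fintype.card (Fin (n + 1)) = n + 1
  exact Fintype.card_fin _

/-- The path has in- and out-degrees `≤ 1`. [folklore] -/
theorem pathNet_degLE (n : ℕ) : (pathNet n).DegLE 1 := by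
  intro v
  refine ⟨Finset.card_le_one.mpr ?_, Finset.card_le_one.mpr ?_⟩
  · intro a ha b hb
    simp only [KPairsNet.inArcs, Finset.mem_filter, Finset.mem_univ, true_and] at ha hb
    exact Fin.succ_injective _ (ha.trans hb.symm)
  · intro a ha b hb
    simp only [KPairsNet.outArcs, Finset.mem_filter, Finset.mem_univ, true_and] at ha hb
    exact Fin.castSucc_injective _ (ha.trans hb.symm)

/-- One undirected step in the path changes the index by at most one (upwards). [folklore] -/
theorem pathNet_adj_val_le (n : ℕ) {u w : (pathNet n).V} (h : (pathNet n).graph.Adj u w) :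
    (w : Fin (n + 2)).val ≤ (u : Fin (n + 2)).val + 1 := by
  rw [KPairsNet.graph, SimpleGraph.fromRel_adj] at h
  obtain ⟨-, ⟨a, ha, hb⟩ | ⟨a, ha, hb⟩⟩ := h
  · change Fin.castSucc a = u at ha
    change Fin.succ a = w at hb
    subst ha; subst hb
    simp
  · change Fin.castSucc a = w at ha
    change Fin.succ a = u at hb
    subst ha; subst hb
    simp only [Fin.val_castSucc, Fin.val_succ]
    omega

/-- Along any undirected walk in the path the index grows by at most the length. [folklore] -/
theorem pathNet_walk_bound (n : ℕ) {u w : (pathNet n).V} (p : (pathNet n).graph.Walk u w) :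
    (w : Fin (n + 2)).val ≤ (u : Fin (n + 2)).val + p.length := by
  induction p with
  | nil => exact Nat.le_add_right _ _
  | @cons a b c h p ih =>
    have hab := pathNet_adj_val_le n h
    rw [SimpleGraph.Walk.length_cons]
    omega

/-- The single pair of `pathNet n` is `(n+1)`-far (its undirected distance is exactly `n + 1`).
[folklore] -/
theorem pathNet_far (n : ℕ) : (pathNet n).Far (n + 1) := by
  intro i
  change ((n + 1 : ℕ) : ℕ∞) ≤ (pathNet n).graph.edist (0 : Fin (n + 2)) (Fin.last (n + 1))
  by_cases hr : (pathNet n).graph.Reachable (0 : Fin (n + 2)) (Fin.last (n + 1))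
  · obtain ⟨p, hp⟩ := hr.exists_walk_length_eq_edist
    rw [← hp]
    have := pathNet_walk_bound n p
    simp only [Fin.val_zero, Fin.val_last, zero_add] at this
    exact_mod_cast this
  · rw [SimpleGraph.edist_eq_top_of_not_reachable hr]
    exact le_top

/-- NON-VACUITY at every scale: for every `n` the hypotheses of `CodingVolume` at `Δ = 1`,
`L = n + 1` are jointly satisfiable, by a network with exactly `n + 1` arcs and one commodity.
[folklore] -/
theorem hypotheses_satisfiable (n : ℕ) :
    ∃ N : KPairsNet Unit, N.DegLE 1 ∧ N.Far (n + 1) ∧ Nonempty N.Code ∧ N.arcCount = n + 1 :=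
  ⟨pathNet n, pathNet_degLE n, pathNet_far n, ⟨pathCode n⟩, pathNet_arcCount n⟩

/-- CEILING / TIGHTNESS: if the volume bound `C · k ≤ m` holds for all `Δ`-bounded, `L`-far coded
networks (`Δ ≥ 1`, `L ≥ 1`), then `C ≤ L`. Hence any witness `L(Δ, C)` for `CodingVolume` has
`L ≥ C`, and the multiple-unicast prediction `L = C` cannot be improved. [folklore] -/
theorem codingVolume_ceiling {Δ C L : ℕ} (hΔ : 1 ≤ Δ) (hL : 1 ≤ L)
    (h : ∀ (ι : Type) [Fintype ι] (N : KPairsNet ι),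
      N.DegLE Δ → N.Far L → Nonempty N.Code → C * Fintype.card ι ≤ N.arcCount) :
    C ≤ L := by
  obtain ⟨n, rfl⟩ : ∃ n, L = n + 1 := ⟨L - 1, by omega⟩
  have key := h Unit (pathNet n) (fun v => ⟨(pathNet_degLE n v).1.trans hΔ,
    (pathNet_degLE n v).2.trans hΔ⟩) (pathNet_far n) ⟨pathCode n⟩
  simpa [pathNet_arcCount] using key

/-- QUANTIFIER ORDER is load-bearing: `CodingVolume` with `∃ L` / `∀ C` SWAPPED (stated inline)
is false — no single distance scale serves every constant (at `Δ = 1`, the path of length `L + 1`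
beats `C = L + 2`). [folklore] -/
theorem codingVolume_false_swapped :
    ¬ ∀ Δ : ℕ, ∃ L : ℕ, ∀ C : ℕ, ∀ (ι : Type) [Fintype ι] (N : KPairsNet ι),
      N.DegLE Δ → N.Far L → Nonempty N.Code → C * Fintype.card ι ≤ N.arcCount := by
  intro h
  obtain ⟨L, hL⟩ := h 1
  -- use the path of length L + 1 (which is (L+1)-far, hence L-far) against C = L + 2
  have far : (pathNet L).Far L := fun i =>
    le_trans (by exact_mod_cast (Nat.le_succ L)) (pathNet_far L i)
  have key := hL (L + 2) Unit (pathNet L) (pathNet_degLE L) far ⟨pathCode L⟩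
  simp [pathNet_arcCount] at key

/-! ## `Far` is load-bearing -/

/-- One arc `0 → 1`, one commodity. [folklore] -/
def arcNet : KPairsNet Unit := pathNet 0

/-- Dropping `Far` makes the crux false (`CodingVolume` without `N.Far L`, stated inline): the
one-arc routing network has a code, degree `1` and `m = k = 1 < 2`. Any proof must use the
distance hypothesis. [folklore] -/
theorem codingVolume_false_without_Far :
    ¬ ∀ Δ C : ℕ, ∀ (ι : Type) [Fintype ι] (N : KPairsNet ι),
      N.DegLE Δ → Nonempty N.Code → C * Fintype.card ι ≤ N.arcCount := by
  intro h
  have key := h 1 2 Unit arcNet (pathNet_degLE 0) ⟨pathCode 0⟩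
  simp [arcNet, pathNet_arcCount] at key

/-! ## `Nonempty N.Code` is load-bearing -/

/-- No arcs, one commodity, source `0`, sink `1`. [folklore] -/
def noArc : KPairsNet Unit where
  V := Fin 2
  A := Empty
  src := fun a => a.elim
  tgt := fun a => a.elim
  rank := Fin.val
  rank_lt := fun a => a.elim
  source := ⟨fun _ => 0, fun _ _ _ => rfl⟩
  sink := ⟨fun _ => 1, fun _ _ _ => rfl⟩
  source_in := fun a => a.elim
  sink_out := fun a => a.elim

/-- `noArc` has all degrees `0`. [folklore] -/
theorem noArc_degLE : noArc.DegLE 0 := by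
  haveI : IsEmpty noArc.A := inferInstanceAs (IsEmpty Empty)
  intro v
  simp [KPairsNet.inArcs, KPairsNet.outArcs]

/-- In `noArc` the pair is undirected-unreachable, hence `Far L` for every `L`. [folklore] -/
theorem noArc_far (L : ℕ) : noArc.Far L := by
  intro i
  rw [SimpleGraph.edist_eq_top_of_not_reachable]
  · exact le_top
  · rintro ⟨w⟩
    cases w with
    | cons h _ =>
      rw [KPairsNet.graph, SimpleGraph.fromRel_adj] at h
      obtain ⟨-, ⟨a, -⟩ | ⟨a, -⟩⟩ := h <;> exact a.elim

/-- `noArc` has no arcs. [folklore] -/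
theorem noArc_arcCount : noArc.arcCount = 0 := rfl

/-- Sanity (A4, junk models): the `Code` interface is NOT inhabitable on `noArc` — a sink with no
in-arcs cannot decode a non-constant bit. So "far because unreachable" never co-occurs with a
code. [folklore] -/
theorem noArc_isEmpty_code : IsEmpty noArc.Code := by
  refine ⟨fun c => ?_⟩
  have := c.decode () (fun _ => true) (fun _ => false) (fun b => b.elim)
  simp at this

/-- Dropping the code makes the crux false (`CodingVolume` without `Nonempty N.Code`, stated
inline; `C = 1`, no arcs, the pair far at every scale). Any proof must use decodability.
[folklore] -/
theorem codingVolume_false_without_Code :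
    ¬ ∀ Δ C : ℕ, ∃ L : ℕ, ∀ (ι : Type) [Fintype ι] (N : KPairsNet ι),
      N.DegLE Δ → N.Far L → C * Fintype.card ι ≤ N.arcCount := by
  intro h
  obtain ⟨L, hL⟩ := h 0 1
  have key := hL Unit noArc noArc_degLE (noArc_far L)
  simp [noArc_arcCount] at key

end Summit.PneNP.PneNP.Theorems.CodingVolume.Negative
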